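import Literature.MathematicalPhysics.QuantumManyBody.PeriodicBoseGasTagged
import Literature.MathematicalPhysics.QuantumManyBody.DyadicCoherentFractionRefinement
import Mathlib.MeasureTheory.Integral.MeanInequalities
import HarnessLib

/-!
# Route `BECProbeMassFlow`, crux `RecoilTransfer` (stmt-AtomisticToContinuum-12311):
# stub `stub_occupationContinuity`

Support file for the crux `RecoilTransfer` (route `BECProbeMassFlow`, line `registered`, skeleton
`Lines/birth.lean` v3): the stub `stub_occupationContinuity` (exact registered name and signature),
the **`L²`-continuity of the tagged zero-mode occupation**. For `(N+1)`-body functions `f, g` on the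
torus `ℝ³/Lℤ³` (one tagged particle `x₀`, `N` bath bosons), the occupation
`A(Ψ) = taggedZeroModeOccupation N L Ψ = L⁻³ ∫_{[0,L)^{3N}} |∫_{[0,L)³} Ψ(x₀, Y) dx₀|² dY = ‖TΨ‖²`
of the constant mode by the tagged particle is the squared norm of the linear contraction
`(TΨ)(Y) = L^{-3/2} ∫_{[0,L)³} Ψ(x₀, Y) dx₀` from `L²([0,L)^{3(N+1)})` to `L²([0,L)^{3N})`, whence
`√A` is `1`-Lipschitz: `√A(f) ≤ √A(g) + ‖f - g‖_{L²(cell^{N+1})}` for continuous `f, g`.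

Proof: slice by slice `∫ f(x,Y) dx = ∫ g(x,Y) dx + ∫ (f - g)(x,Y) dx` (continuous slices are
integrable on the bounded cell), so `|Tf| ≤ |Tg| + |T(f-g)|` pointwise; Minkowski in `L²(cell^N)`
(`ENNReal.lintegral_Lp_add_le`, `p = 2`) gives `‖Tf‖ ≤ ‖Tg‖ + ‖T(f-g)‖`; and `T` is a contraction
(Cauchy–Schwarz on the cell `|∫ h(x,Y) dx|² ≤ L³ ∫ |h(x,Y)|² dx`, then Tonelli with the tagged
coordinate innermost). Elementary; every `N`, every `L > 0`.
-/

noncomputable section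

open MeasureTheory
open scoped ENNReal NNReal

namespace Summit.AtomisticToContinuum.BoseEinsteinCondensation.Theorems

open Literature.MathematicalPhysics.QuantumManyBody.BoseGas

variable {N : ℕ} {L : ℝ}

/-! ### Slices of continuous functions along the tagged coordinate -/

/-- The slice `x ↦ f(x, Y)` of a continuous `(N+1)`-body function is continuous. [folklore] -/
private theorem continuous_tagSlice_recoil {f : Config (N + 1) → ℂ} (hf : Continuous f)
    (Y : Config N) : Continuous fun x : Space => f (Matrix.vecCons x Y) :=
  hf.comp (continuous_id.matrixVecCons continuous_const)

/-- The slice `x ↦ f(x, Y)` of a continuous `(N+1)`-body function is integrable on the cell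
`[0,L)³`. [folklore] -/
private theorem integrableOn_tagSlice_recoil {f : Config (N + 1) → ℂ} (hf : Continuous f)
    (Y : Config N) : IntegrableOn (fun x : Space => f (Matrix.vecCons x Y)) (cell L) volume :=
  integrableOn_cell (continuous_tagSlice_recoil hf Y)

/-! ### The zero-mode projection of the tagged particle is a contraction -/

/-- **Slice Cauchy–Schwarz**: `|∫_{[0,L)³} h(x, Y) dx|² ≤ L³ ∫_{[0,L)³} |h(x, Y)|² dx` for
measurable `h`. [folklore] -/
private theorem sq_nnnorm_setIntegral_tagSlice_le_recoil {h : Config (N + 1) → ℂ}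
    (hh : Measurable h) (Y : Config N) :
    (‖∫ x in cell L, h (Matrix.vecCons x Y)‖₊ : ℝ≥0∞) ^ 2 ≤
      ENNReal.ofReal L ^ 3 * ∫⁻ x in cell L, (‖h (Matrix.vecCons x Y)‖₊ : ℝ≥0∞) ^ 2 := by
  have hCS := sq_nnnorm_integral_mul_conj_le (ν := volume.restrict (cell L))
    (f := fun x => h (Matrix.vecCons x Y)) (g := fun _ => (1 : ℂ))
    (measurable_comp_vecCons_left hh Y).aemeasurable aemeasurable_const
  simp only [map_one, mul_one, nnnorm_one, ENNReal.coe_one, one_pow, lintegral_const,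
    Measure.restrict_apply_univ, volume_cell, one_mul] at hCS
  exact hCS.trans_eq (mul_comm _ _)

/-- **The tagged zero-mode projection is a contraction**:
`taggedZeroModeOccupation N L h ≤ ∫_{[0,L)^{3(N+1)}} |h|²` for measurable `h` and `L > 0`
(slice Cauchy–Schwarz, then Tonelli with the tagged coordinate innermost). [folklore] -/
private theorem taggedZeroModeOccupation_le_lintegral_sq_recoil (hL : 0 < L)
    {h : Config (N + 1) → ℂ} (hh : Measurable h) :
    taggedZeroModeOccupation N L h ≤ ∫⁻ X in cellN (N + 1) L, (‖h X‖₊ : ℝ≥0∞) ^ 2 := by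
  have hF : Measurable fun X => (‖h X‖₊ : ℝ≥0∞) ^ 2 := (hh.nnnorm.coe_nnreal_ennreal).pow_const _
  have hL3 : ENNReal.ofReal L ^ 3 ≠ 0 := pow_ne_zero _ (ENNReal.ofReal_pos.2 hL).ne'
  have hL3' : ENNReal.ofReal L ^ 3 ≠ ⊤ := ENNReal.pow_ne_top ENNReal.ofReal_ne_top
  calc taggedZeroModeOccupation N L h
      ≤ (ENNReal.ofReal L ^ 3)⁻¹ * ∫⁻ Y in cellN N L,
          ENNReal.ofReal L ^ 3 * ∫⁻ x in cell L, (‖h (Matrix.vecCons x Y)‖₊ : ℝ≥0∞) ^ 2 := by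
        rw [taggedZeroModeOccupation_def]
        exact mul_le_mul_right
          (lintegral_mono fun Y => sq_nnnorm_setIntegral_tagSlice_le_recoil hh Y) _
    _ = ∫⁻ X in cellN (N + 1) L, (‖h X‖₊ : ℝ≥0∞) ^ 2 := by
        rw [lintegral_const_mul' _ _ hL3', setLIntegral_cellN_succ_right hF, ← mul_assoc,
          ENNReal.inv_mul_cancel hL3 hL3', one_mul]

/-! ### Minkowski for the slice means -/

/-- **Triangle inequality for the slice means in `L²(cell^N)`**: with
`(Sh)(Y) = ∫_{[0,L)³} h(x, Y) dx`,
`‖Sf‖_{L²(cell^N)} ≤ ‖Sg‖_{L²(cell^N)} + ‖S(f - g)‖_{L²(cell^N)}` for continuous `f, g`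
(pointwise `|Sf| ≤ |Sg| + |S(f-g)|` by linearity of the slice integral, then Minkowski
`ENNReal.lintegral_Lp_add_le` with `p = 2`). [folklore] -/
private theorem lintegral_sq_sliceMean_rpow_half_le_recoil {f g : Config (N + 1) → ℂ}
    (hf : Continuous f) (hg : Continuous g) :
    (∫⁻ Y in cellN N L, (‖∫ x in cell L, f (Matrix.vecCons x Y)‖₊ : ℝ≥0∞) ^ 2) ^ (1 / 2 : ℝ) ≤
      (∫⁻ Y in cellN N L, (‖∫ x in cell L, g (Matrix.vecCons x Y)‖₊ : ℝ≥0∞) ^ 2) ^ (1 / 2 : ℝ) +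
        (∫⁻ Y in cellN N L, (‖∫ x in cell L, (f (Matrix.vecCons x Y) - g (Matrix.vecCons x Y))‖₊ :
          ℝ≥0∞) ^ 2) ^ (1 / 2 : ℝ) := by
  set F : Config N → ℝ≥0∞ := fun Y => ‖∫ x in cell L, g (Matrix.vecCons x Y)‖₊ with hFdef
  set G : Config N → ℝ≥0∞ := fun Y =>
    ‖∫ x in cell L, (f (Matrix.vecCons x Y) - g (Matrix.vecCons x Y))‖₊ with hGdef
  have hFm : Measurable F :=
    (measurable_setIntegral_vecCons hg.measurable (cell L)).nnnorm.coe_nnreal_ennreal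
  have hGm : Measurable G :=
    (measurable_setIntegral_vecCons (Ψ := fun X => f X - g X) (hf.sub hg).measurable
      (cell L)).nnnorm.coe_nnreal_ennreal
  -- pointwise triangle inequality for the slice means
  have hpt : ∀ Y : Config N, (‖∫ x in cell L, f (Matrix.vecCons x Y)‖₊ : ℝ≥0∞) ≤ F Y + G Y := by
    intro Y
    have hsplit : ∫ x in cell L, f (Matrix.vecCons x Y) =
        (∫ x in cell L, g (Matrix.vecCons x Y)) +
          ∫ x in cell L, (f (Matrix.vecCons x Y) - g (Matrix.vecCons x Y)) := by
      rw [integral_sub (integrableOn_tagSlice_recoil hf Y) (integrableOn_tagSlice_recoil hg Y),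
        add_sub_cancel]
    rw [hsplit, hFdef, hGdef, ← ENNReal.coe_add, ENNReal.coe_le_coe]
    exact nnnorm_add_le _ _
  have hp : (1 : ℝ) ≤ 2 := by norm_num
  calc (∫⁻ Y in cellN N L, (‖∫ x in cell L, f (Matrix.vecCons x Y)‖₊ : ℝ≥0∞) ^ 2) ^ (1 / 2 : ℝ)
      ≤ (∫⁻ Y in cellN N L, (F + G) Y ^ (2 : ℝ)) ^ (1 / 2 : ℝ) := by
        refine ENNReal.rpow_le_rpow (lintegral_mono fun Y => ?_) (by norm_num)
        rw [ENNReal.rpow_two, Pi.add_apply]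
        gcongr
        exact hpt Y
    _ ≤ (∫⁻ Y in cellN N L, F Y ^ (2 : ℝ)) ^ (1 / 2 : ℝ) +
          (∫⁻ Y in cellN N L, G Y ^ (2 : ℝ)) ^ (1 / 2 : ℝ) :=
        ENNReal.lintegral_Lp_add_le hFm.aemeasurable hGm.aemeasurable hp
    _ = _ := by simp only [hFdef, hGdef, ENNReal.rpow_two]

/-! ### The stub -/

/-- **`√A` is `1`-Lipschitz in `L²`** (registered stub `stub_occupationContinuity` of the crux
`RecoilTransfer`): for continuous `(N+1)`-body functions `f, g` on a torus of side `L > 0`,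
`A(f)^{1/2} ≤ A(g)^{1/2} + (∫_{[0,L)^{3(N+1)}} |f - g|²)^{1/2}` with
`A = taggedZeroModeOccupation N L` — the occupation of the constant mode by the tagged particle is
the squared norm of a linear contraction `L²(cell^{N+1}) → L²(cell^N)`. [folklore] -/
theorem stub_occupationContinuity :
    ∀ (N : ℕ) (L : ℝ), 0 < L → ∀ f g : Config (N + 1) → ℂ, Continuous f → Continuous g →
      taggedZeroModeOccupation N L f ^ (1 / 2 : ℝ) ≤
        taggedZeroModeOccupation N L g ^ (1 / 2 : ℝ) +
          (∫⁻ X in cellN (N + 1) L, (‖f X - g X‖₊ : ℝ≥0∞) ^ 2) ^ (1 / 2 : ℝ) := by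
  intro N L hL f g hf hg
  have hhalf : (0 : ℝ) ≤ 1 / 2 := by norm_num
  set c : ℝ≥0∞ := (ENNReal.ofReal L ^ 3)⁻¹
  -- the contraction bound for `f - g`
  have hcontr : c * ∫⁻ Y in cellN N L,
      (‖∫ x in cell L, (f (Matrix.vecCons x Y) - g (Matrix.vecCons x Y))‖₊ : ℝ≥0∞) ^ 2 ≤
      ∫⁻ X in cellN (N + 1) L, (‖f X - g X‖₊ : ℝ≥0∞) ^ 2 :=
    taggedZeroModeOccupation_le_lintegral_sq_recoil (h := fun X => f X - g X) hL
      (hf.sub hg).measurable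
  calc taggedZeroModeOccupation N L f ^ (1 / 2 : ℝ)
      = c ^ (1 / 2 : ℝ) *
          (∫⁻ Y in cellN N L, (‖∫ x in cell L, f (Matrix.vecCons x Y)‖₊ : ℝ≥0∞) ^ 2) ^
            (1 / 2 : ℝ) := by
        rw [taggedZeroModeOccupation_def, ENNReal.mul_rpow_of_nonneg _ _ hhalf]
    _ ≤ c ^ (1 / 2 : ℝ) *
          ((∫⁻ Y in cellN N L, (‖∫ x in cell L, g (Matrix.vecCons x Y)‖₊ : ℝ≥0∞) ^ 2) ^
              (1 / 2 : ℝ) +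
            (∫⁻ Y in cellN N L, (‖∫ x in cell L,
              (f (Matrix.vecCons x Y) - g (Matrix.vecCons x Y))‖₊ : ℝ≥0∞) ^ 2) ^ (1 / 2 : ℝ)) :=
        mul_le_mul_right (lintegral_sq_sliceMean_rpow_half_le_recoil hf hg) _
    _ = taggedZeroModeOccupation N L g ^ (1 / 2 : ℝ) +
          (c * ∫⁻ Y in cellN N L, (‖∫ x in cell L,
            (f (Matrix.vecCons x Y) - g (Matrix.vecCons x Y))‖₊ : ℝ≥0∞) ^ 2) ^ (1 / 2 : ℝ) := by
        rw [mul_add, taggedZeroModeOccupation_def, ENNReal.mul_rpow_of_nonneg _ _ hhalf,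
          ENNReal.mul_rpow_of_nonneg _ _ hhalf]
    _ ≤ taggedZeroModeOccupation N L g ^ (1 / 2 : ℝ) +
          (∫⁻ X in cellN (N + 1) L, (‖f X - g X‖₊ : ℝ≥0∞) ^ 2) ^ (1 / 2 : ℝ) := by
        gcongr

end Summit.AtomisticToContinuum.BoseEinsteinCondensation.Theorems

end
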